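import Mathlib
import HarnessLib
import HarnessLib.Audit
import Summits.CriticalPhenomena.Statement
import Literature.Probability.LatticeModels.PairIsing
import HarnessLib.Audit.Status.Attr

/-!
Route: LocalisationClock

DORMANT since 2026-09-01T18:02:53Z (reconciler: no traction for 5 d (last activity statement-checked at 2026-08-27T17:30:33Z); parked, not closed — `ledger route dormant route-CriticalPhenomena-LocalisationClock --off` to reactivate) — unstaffed, not closed; items shared with open routes are served there. `ledger route dormant <id> --off` reactivates.

# Route LocalisationClock — U4 on Z^3 is the noise of its own localisation clock — kappa4 =
6∫Cov(rate, polarisation²) at the Imry–Ma time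

It suffices to show X = LocalisationGHS ∧ ImryMaWindowNoise (spine card localization-clock-kappa4,
its K1 + a sharpened K2), read through
the EXACT clock identity κ₄(M_L) = 6∫₀^∞ Cov(r_s, M_s²) ds of the critical block spin M_L =
Σ_(x∈Λ_L) σ_x under its own stochastic
localisation (planted Gaussian channel y_s = sσ* + B_s, posterior μ_s ∝ μ·e^⟨y_s,σ⟩, M_s = E_(μ_s)
M, r_s = ‖Cov_(μ_s)(σ)𝟙‖² the rate of the
clock). LocalisationGHS (rank 2, NEW correlation inequality): for every finite ferromagnet observed
through a Gaussian channel on any subset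
of sites, Cov(r_s, M_s²) ≤ 0 at every SNR s — Lebowitz at s → 0, GHS for coherent fields, ≡ 0 for
Gaussians. ImryMaWindowNoise (rank 3,
the only ℤ³-specific input): on the interquantile window of the critical clock (aσ_L² ≤ E M_s² ≤
bσ_L²) the anti-correlation is ORDER ONE,
−Cov ≥ c·E r_s·E M_s². Then g_L := (3⟨M_L²⟩² − ⟨M_L⁴⟩)/⟨M_L²⟩² ≥ 6ca(b−a) > 0 (Target), which no
scale-covariant Gaussian limit allows
(shared support GaussianLimitKillsBlockCoupling, item 4950); with the shared complement
MoebiusLimitExists (item 1344) the conjunct follows.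
Lean: `(∀ (n : ℕ) (c : Fin n → Fin n → ℝ) (e : Fin n → Bool) (s : ℝ), (∀ a b, 0 ≤ c a b) → 0 ≤ s →
let tilt : (Fin n → ℝ) → (Literature.Probability.LatticeModels.SpinConfig (Fin n) → ℝ) → ℝ := fun y
g => Literature.Probability.LatticeModels.PairIsing.gibbsAvg c (fun σ => g σ * Real.exp (∑ a, y a *
Literature.Probability.LatticeModels.spinAt a σ)) /
Literature.Probability.LatticeModels.PairIsing.gibbsAvg c (fun σ => Real.exp (∑ a, y a *
Literature.Probability.LatticeModels.spinAt a σ)); let blk :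
Literature.Probability.LatticeModels.SpinConfig (Fin n) → ℝ := fun σ => ∑ a, if e a then
Literature.Probability.LatticeModels.spinAt a σ else 0; let m : (Fin n → ℝ) → ℝ := fun y => tilt y
blk; let Af : (Fin n → ℝ) → Fin n → ℝ := fun y a => tilt y (fun σ =>
Literature.Probability.LatticeModels.spinAt a σ * blk σ) - tilt y
(Literature.Probability.LatticeModels.spinAt a) * m y; let r : (Fin n → ℝ) → ℝ := fun y => ∑ a, if e
a then Af y a ^ 2 else 0; let P : ((Fin n → ℝ) → ℝ) → ℝ := fun Φ =>
Literature.Probability.LatticeModels.PairIsing.gibbsAvg c (fun σ => ∫ z, Φ (fun a => if e a then s *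
Literature.Probability.LatticeModels.spinAt a σ + Real.sqrt s * z a else 0) ∂(Measure.pi fun _ : Fin
n => ProbabilityTheory.gaussianReal 0 1)); P (fun y => r y * m y ^ 2) ≤ P r * P (fun y => m y ^ 2))
∧ (let βc : ℝ := Literature.Probability.LatticeModels.criticalBeta 3; let w : (L : ℕ) →
(↥(Literature.Probability.LatticeModels.box 3 L) → ℤˣ) → ℝ := fun L τ =>
Literature.Probability.LatticeModels.plusExpect 3 βc 0 (fun σ => if (∀ x :
↥(Literature.Probability.LatticeModels.box 3 L), σ x = τ x) then 1 else 0); let tilt : (L : ℕ) →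
(↥(Literature.Probability.LatticeModels.box 3 L) → ℝ) → ((↥(Literature.Probability.LatticeModels.box
3 L) → ℤˣ) → ℝ) → ℝ := fun L y g => (∑ τ, w L τ * g τ * Real.exp (∑ x, y x * ((τ x : ℤ) : ℝ))) / (∑
τ, w L τ * Real.exp (∑ x, y x * ((τ x : ℤ) : ℝ))); let m : (L : ℕ) →
(↥(Literature.Probability.LatticeModels.box 3 L) → ℝ) → ℝ := fun L y => tilt L y (fun τ => ∑ x, ((τ
x : ℤ) : ℝ)); let Af : (L : ℕ) → (↥(Literature.Probability.LatticeModels.box 3 L) → ℝ) →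
↥(Literature.Probability.LatticeModels.box 3 L) → ℝ := fun L y x => tilt L y (fun τ => ((τ x : ℤ) :
ℝ) * ∑ x', ((τ x' : ℤ) : ℝ)) - tilt L y (fun τ => ((τ x : ℤ) : ℝ)) * m L y; let r : (L : ℕ) →
(↥(Literature.Probability.LatticeModels.box 3 L) → ℝ) → ℝ := fun L y => ∑ x, Af L y x ^ 2; let P :
(L : ℕ) → ℝ → ((↥(Literature.Probability.LatticeModels.box 3 L) → ℝ) → ℝ) → ℝ := fun L s Φ => ∑ τ, w
L τ * ∫ z, Φ (fun x => s * ((τ x : ℤ) : ℝ) + Real.sqrt s * z x) ∂(Measure.pi fun _ :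
↥(Literature.Probability.LatticeModels.box 3 L) => ProbabilityTheory.gaussianReal 0 1); let σ2 : ℕ →
ℝ := fun L => Literature.Probability.LatticeModels.plusExpect 3 βc 0 (fun σ => (∑ x ∈
Literature.Probability.LatticeModels.box 3 L, Literature.Probability.LatticeModels.spinAt x σ) ^ 2);
∃ a b c : ℝ, 0 < a ∧ a < b ∧ b < 1 ∧ 0 < c ∧ ∃ L₀ : ℕ, ∀ L ≥ L₀, ∀ s : ℝ, 0 ≤ s → a * σ2 L ≤ P L s
(fun y => m L y ^ 2) → P L s (fun y => m L y ^ 2) ≤ b * σ2 L → P L s (fun y => r L y * m L y ^ 2) -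
P L s (r L) * P L s (fun y => m L y ^ 2) ≤ -(c * (P L s (r L) * P L s (fun y => m L y ^ 2))))`

## Assembly
Pure logic given the items (sorry-free `closes` in glue.lean, checked in Sketch.lean):
MoebiusLimitExists yields (ρ, Δ, S) with clauses (i)–(ii);
if HasNontrivialU4 S failed, GaussianLimitKillsBlockCoupling (fed
IsMoebiusCovariant.isScaleCovariant) gives g_L → 0, contradicting the floor
g_L ≥ c > 0 eventually that TargetOfClock extracts from LocalisationGHS and ImryMaWindowNoise; hence
clause (iii) and the conjunct.

Rationale: WHY THIS LINE. The identity is two lines of Itô (d(M⁴) = 4M³dM + 6M²r ds; (Eτ)² = 2∫E r_s·E M_s² ds,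
re-derived here and checked by exact enumeration): the
fourth Ursell function of the target measure — all of clause (iii) at block level — becomes a
time-integrated covariance of two SECOND-order
posterior quantities along Eldan's localisation = the Polchinski/planted-RFIM flow of
Bauerschmidt–Bodineau–Dagallier (arXiv:2307.07619 §4.5,
§6.3) and El Alaoui–Montanari (arXiv:2109.00709), which so far outputs log-Sobolev constants, never
cumulants of the target. Lebowitz becomes
negative dependence ("blocks that stay soft longer end up less magnetised"), Gaussianity becomes
"the clock is deterministic", and U₄ ≢ 0 on
ℤ³ becomes Aharony–Harris non-self-averaging (doi:10.1103/physrevlett.77.3700) of a PLANTED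
random-field block susceptibility at the
parameter-free Imry–Ma time t* ≍ |Λ_L|/σ_L² (envelopes from Ding–Song–Sun domination
arXiv:2107.09243 + FKG + a Riccati bound). Imported areas:
stochastic localisation / martingale embeddings (high-dimensional probability, arXiv:1806.09087),
Bayes-planted models (Nishimori line),
random-field critical phenomena. What no listed route does: the 12 clause-(iii) routes handle U₄
through random-current geometry
(EnergyNotSigmaSquared, FKParityRobustness, ArmHyperscaling), thermodynamic faces
(GammaForcesInteraction, LeeYangGap, SubPtolemyInterlacing),
information contraction (OctaveForgetting) or the sibling erasure channel with envelopes only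
(PlantedPinning); none writes U₄ as an exact
identity along a flow of the measure, and none reduces (iii) to a one-scale anti-concentration
statement. Negatives index: nothing on this sub.

RANKED CRUXES. #0 Target (target) — block form of clause (iii): the dimensionless block coupling g_L
= (3⟨M_L²⟩² − ⟨M_L⁴⟩)/⟨M_L²⟩² of the critical + state on ℤ³ (M_L = total spin of box 3 L) has a
positive floor for all large L (the expression is verbatim that of the shared support item 4950).
(why it might fail: it IS non-triviality at block level: g_L → 0 iff the block spin is
asymptotically Gaussian (Newman/Aizenman U₄ criterion); numerics give g_L → 3·0.47-type Binder
values > 0 but no rigorous floor exists in d = 3.) [Aizenman1982, AizenmanDuminilCopinAnnals2021,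
Newman1975, DuminilCopinICM2022]
#2 LocalisationGHS (crux) — SL-GHS, block form with partial observation (card K1 in the weakest form
the assembly needs): for every finite set of sites with ferromagnetic pair couplings c ≥ 0 (zero
field), every observed block e ⊆ sites and every SNR s ≥ 0 — with σ* ~ Gibbs(c), Z standard
Gaussian, fields y_a = sσ*_a + √s Z_a on the block and 0 off it, posterior = Gibbs(c) tilted by
e^⟨y,σ⟩, block spin M_e = Σ_(a∈e) σ_a, m(y) = E_y M_e, r(y) = Σ_(a∈e) Cov_y(σ_a, M_e)² (the clock
rate) — E[r·m²] ≤ E[r]·E[m²] over the planted law. The posterior block stiffness and the squared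
posterior block polarisation are negatively correlated: an inequality interpolating Lebowitz
(coefficient 2s²·U₄(G𝟙,𝟙,G𝟙,G𝟙) ≤ 0 at s → 0), GHS (coherent field) and Wick (≡ 0 for Gaussian
laws); product measures satisfy it sitewise (Chebyshev). The general-f ≥ 0 version of the card is
the natural strengthening, not filed. [difficulty: L] (why it might fail: no pathwise monotonicity
of truncated correlations along signed field rays (Ding–Song–Sun Rem. 1.4): the sign must come from
the planted average (Nishimori) and could fail at intermediate s on frustrated-looking fields of
non-negligible weight, or under partial observation (tested only to N ≤ 5).) [arXiv:2107.09243,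
arXiv:1806.09087, arXiv:2109.00709, doi:10.1103/physreve.60.132, Lebowitz1974]
#3 ImryMaWindowNoise (crux) — anti-concentration of the critical clock (card K2, sharpened to ONE
inequality on a parameter-free window): for the marginal w_L of the critical + state of ℤ³ on box 3
L, localised through the Gaussian channel on the box with f = 𝟙 (block spin), there are 0 < a < b <
1 and c > 0 such that for all large L and every s ≥ 0 with a·σ_L² ≤ E M_s² ≤ b·σ_L² (the
interquantile window of the clock, which the DSS/FKG/Riccati envelopes place at the Imry–Ma time s ≍
|Λ_L|/σ_L² ≍ L^-(2−η)): Cov(r_s, M_s²) ≤ −c·E r_s·E M_s². Order-one relative noise of the planted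
block susceptibility and its order-one anti-correlation with the squared polarisation at the
crossover ξ_RF(s) ≍ L. [deps: LocalisationGHS] [difficulty: open-problem] (why it might fail:
self-averaging returns if screening at the window is decided by many weakly dependent sub-block
events (CLT ⇒ std r_s/E r_s → 0, as in d ≥ 4 where g_L → 0 forces it); the bet (Aharony–Harris, y_RF
= 1 − η/2 > 0) is O(1) sub-blocks at ξ_RF(t*) = L; only toy evidence (ratio 0.3–0.7, N ≤ 5).)
[doi:10.1103/physrevlett.77.3700, arXiv:2107.09243, arXiv:2307.07619,
AizenmanDuminilCopinAnnals2021]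
#4 MoebiusLimitExists (crux) — IMPORTED COMPLEMENT (shared item stmt-CriticalPhenomena-1344,
verbatim): the critical correlators on ℤ³ have a non-degenerate pointwise scaling limit (ρ > 0 on
(0,1], Δ > 0, S) that is Möbius covariant with dimension Δ — the conjunct minus clause (iii). Not
attacked here; this route bets on the existence/covariance lines (HyperoctahedralRP,
MirrorHoelderCompactness, ClusterRigidity, …). [difficulty: open-problem] (why it might fail:
existence of the full δ→0⁺ limit, O(3) invariance and inversion covariance are each open on ℤ³ (ICM
2022 §8.4 p.29); Euclidean + scale data never force inversion (ScaleCovarianceNotMoebius); imported,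
not attacked.) [DuminilCopinICM2022, PolandRychkovVichi2019,
Literature.Barriers.CriticalPhenomena.ScaleCovarianceNotMoebius]
#9 TargetOfClock (support) — the clock reading: LocalisationGHS → ImryMaWindowNoise → Target. Proof
(planner NOTES §Route design): (1) ClockIdentity for the symmetric finite law w_L (the + state at
β_c(3) is flip-symmetric: m*(β_c) = 0, ADS 2015, in-tree
MagnetizationContinuity/LebowitzMagnetizationCriterion) with f = 𝟙 gives 6∫₀^∞ Cov = ⟨M⁴⟩ − 3⟨M²⟩²
and ∫_(s₁)^(s₂) E r = E M_(s₂)² − E M_(s₁)²; (2) LocalisationGHS applied to the free-b.c. zero-field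
boxes Λ' ⊇ Λ_L (PairIsing.gibbsAvg with c = β_c·adjacency, mask e = 𝟙_Λ, f = 𝟙_Λ) is EXACTLY the
clock functional of the Λ-marginal of μ^free_(Λ'); it is continuous in that finite law, and
μ^free_(Λ') → + state at β_c (uniqueness), so Cov_L(s) ≤ 0 for all s; (3) s ↦ E M_s² is continuous
nondecreasing from 0 to σ_L², so the window [s₁,s₂] with E M² = aσ², bσ² exists and carries ∫E r =
(b−a)σ_L²; on it −Cov ≥ c·aσ_L²·E r_s, hence 3⟨M²⟩² − ⟨M⁴⟩ = −κ₄ ≥ 6ca(b−a)σ_L⁴. [difficulty: M]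
[arXiv:1806.09087, FriedliVelenik2017, AizenmanDuminilCopinSidoravicius2015]
#9 ClockIdentity (support) — THE DICTIONARY (card P1, provable now by Gaussian calculus): for every
finite flip-symmetric probability weight w on (Fin n → ℤˣ) and every f, with the clock functionals
of the Gaussian channel (tilt by e^⟨y,τ⟩, m, Af, r as in LocalisationGHS with full observation, P_s
= planted expectation at SNR s, cov(s) = P_s[r m²] − P_s[r]P_s[m²]): (i) ∫_(s₁)^(s₂) P_s[r] ds =
P_(s₂)[m²] − P_(s₁)[m²] (the clock: d E M_s² = E r_s ds); (ii) cov is integrable on (0,∞); (iii)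
6∫₀^∞ cov = Σ w⟨f,τ⟩⁴ − 3(Σ w⟨f,τ⟩²)² = κ₄. Two lines of Itô for the continuous martingale M_s (or
de Bruijn/heat-equation differentiation under the Gaussian integral, which avoids stochastic
calculus in Lean). [difficulty: L] [arXiv:1806.09087, doi:10.1214/15-aihp682, arXiv:2109.00709]
#9 GaussianLimitKillsBlockCoupling (support) — SHARED transfer glue (item
stmt-CriticalPhenomena-4950 of route LeeYangGap, verbatim): if (ρ, Δ, S) is a pointwise scaling
limit of criticalCorr 3 with non-degenerate two-point function, scale covariant with dimension Δ,
and U₄^S ≡ 0 on non-coincident configurations, then g_L → 0 (Lebowitz + Griffiths pairing bound near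
the diagonal, locally uniform convergence off it, MMS doubling and Potter bounds for the regularly
varying normalisation). [difficulty: L] [AizenmanDuminilCopinAnnals2021, Lebowitz1974,
Literature.Probability.LatticeModels.messager_miracleSole_holds]

TWO-LAYER PLAN. Foreseen glued splits, filed only when a crux closes or stalls: LocalisationGHS ⇐
(SmallSNR: the inequality for s ≤ s₀(c,f) from the 2s²U₄
expansion with a controlled remainder) → (LargeSNR: localised tail, posterior a perturbation of
δ_σ*) → (MidSNR: the Nishimori-averaged sign) →
LocalisationGHS; ImryMaWindowNoise ⇐ (RFIMDictionary: E Σ_y Cov_(μ_s)(σ₀,σ_y) ≍ min(χ_L, s⁻¹), E r_s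
≍ min(‖G𝟙‖², L³s⁻²), card K3) →
(WindowAnticoncentration at one scale) → ImryMaWindowNoise (k ≤ 3, depth 1).

KILL CRITERIA. ONE finite ferromagnet, block e and s with Cov(r_s, m²) > 0 beyond numerical error
refutes LocalisationGHS as typed — close
`refuted:LocalisationGHS` unless the witness needs partial observation of a strict sub-block, in
which case pivot to the full-observation form
(e = all sites, card K1 with f = 𝟙) with TargetOfClock re-proved through free-b.c. block laws (the
window law then changes with the b.c.). A 3D two-replica Monte Carlo of the planted RFIM at β_c(3)
(L = 16–48)
showing −Cov/(E r·E M²) → 0 on the window kills ImryMaWindowNoise and, through the identity +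
necessary condition (c) of the card, is evidence FOR
Gaussianity — close `refuted:ImryMaWindowNoise`. Target proved by any other clause-(iii) route
(EnergyNotSigmaSquared, FKParityRobustness, LeeYangGap …)
moots ranks 2–3 as a route to the summit (LocalisationGHS keeps stand-alone value);
MoebiusLimitExists refuted ⇒ the conjunct is false and every
U₄ route dies with it.

NOT DECOMPOSED YET. The RFIM dictionary at β_c (card K3: screening length ξ_RF(s) ≍ s^(−1/(2−η)),
envelopes as ≍ laws) — it locates the window but is off the
critical path after the interquantile reformulation; the DSS/FKG/Riccati envelopes (provable now,
used only to interpret the window); the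
polarised identity for U₄(f₁,…,f₄) and its random-current reading (card P2); constants a, b, c; any
continuum (SPDE) formulation of the clock.

CHEAPEST FALSIFIER. Exact-enumeration stochastic localisation on small ferromagnets hunting ONE
positive Cov(r_s, m²). RUN this session, independently of the
card's Monte-Carlo-over-paths runs: exp/slghs_pure.py and exp/slghs_pure_mask.py (tensor
Gauss–Hermite quadrature over the channel noise,
exact posteriors; N ≤ 4; full AND partial observation; chains, triangles, rings, K4, strong+weak
bonds, random log-uniform couplings, random
f ≥ 0; 16–19 SNR values per case): identity reproduced (κ₄ = −13.957 vs 6∫Cov ≈ −14.8, −19.9 vs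
−22.4, … with a coarse trapezoid that
over-weights the tail), NO positive covariance at any (system, s) where the integrand is above
quadrature error (23 cases), and the window
ratio −Cov/(E r·E m²) = 0.3–0.7 where E m² ≈ σ²/2 (tables in NOTES.md). Wider numpy sweeps (N ≤ 5,
49 SNRs, ≈ 300 (system, f, mask)
triples, quadrature with node-count error proxy) queued as kit j019137 (full observation) and
j019138 (masks) on a saturated farm; their
one-line verdicts go to NOTES.md / item evidence on resume. Next cheapest: DSS's appendix
counterexample graph through the same script.

NUMBERS. g_L on periodic cubes → 3·U₄* with Binder cumulant U₄* = 0.4655(3) for 3D Ising (Hasenbusch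
2010, arXiv:1004.4486) vs 0 for a Gaussian;
η = 0.0363, so t*_L ≍ L^−(2−η) = L^−1.964; y_RF = 1 − η/2 > 0 (random field relevant at the pure
fixed point); identity checked to ≤ 1 %
by the card (12 systems) and here (23 cases). Items at open: 8 (1 target, 3 cruxes, 3 supports, 1
assembly).

DEFINITION REQUESTS. None. Everything is typed over existing declarations:
Literature.Probability.LatticeModels.PairIsing.gibbsAvg (finite ferromagnets),
plusExpect / criticalBeta / box / spinAt (critical + state), Mathlib's Measure.pi of
ProbabilityTheory.gaussianReal 0 1 (the channel),
intervalIntegral / IntegrableOn (the clock identity), and the ScalingLimit / ConformalCovariance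
predicates. Optional later: named
`localisationTilt`, `clockRate`, `clockMean` abbreviations under
Summits/CriticalPhenomena/Ising3DConformalLimit/Theorems if provers want them.

Novelty: Searches (2026-08-16): `lit search --source arxiv` ×3 ("stochastic localization Ising cumulant": 0;
"Polchinski flow Ising model
renormalisation group correlation inequality": 0; "random field Ising model self-averaging
susceptibility critical": 4, RFIM numerics only);
`lit search --hybrid` ×3 (held: GAFA 2011–2023 volumes with Eldan's localisation notes,
arXiv:2109.00709; nothing joining SL to lattice
criticality); `lit galaxy search --star all` ×4 ("stochastic localization": 16 generic rows;
"Polchinski equation Ising", "martingale embedding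
fourth moment", "Binder cumulant rigorous": 0 each); `lit search --source s2` "random currents Ising
loop soup GFF" (11, used to kill my own
loop-soup candidate); openalex/s2 rate-limited (429) for the rest — plus the spine card's and its
critic's searches (crossref ×6, galaxy, grep of
arXiv:1806.09087 / 2307.07619 for fourth|cumulant: 0). `ledger negatives --problem
CriticalPhenomena`: 10, none on this sub.
Nearest prior art found: arXiv:2307.07619 + doi:10.1214/24-ps27 (Bauerschmidt–Bodineau–Dagallier: SL
= Polchinski flow for Ising up to β_c,
outputs log-Sobolev/mixing, never cumulants of the target); arXiv:1806.09087 (Eldan–Mikulincer–Zhai: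
martingale embeddings, "Γ deterministic ⇔
Gaussian", upper bounds only); arXiv:2109.00709 (the planted Gaussian channel as an object); on THIS
problem the sibling route PlantedPinning
(erasure channel, envelopes + a conjectural gauge e* < 1, no identity).
Delta: nobody has written a cumulant of t  [refs: 10.1214/24-ps27, 2109.00709, 1806.09087, 2307.07619, doi:10.1214/24-ps27]

Barriers (technique_class: stochastic-localisation, cumulant-identity, planted-rfim): - technique_class: stochastic-localisation, cumulant-identity, planted-rfim
- Literature.Barriers.CriticalPhenomena.IsingTrivialityFromDimensionFour: evaded by design — the
identity, LocalisationGHS and the transfer hold in every d (in d ≥ 5 "integrand relatively small" is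
what Gaussianity means), and the single ℤ³-specific input ImryMaWindowNoise is FALSE in d ≥ 4 by the
barrier's own theorems read through the identity, so the line cannot be dimension-blind.
- Literature.Barriers.CriticalPhenomena.LongRangeTrivialityOnZ3: same — for RP long-range α < 3/2 on
ℤ³ the planted block susceptibility must self-average at its window; ImryMaWindowNoise is
nearest-neighbour-specific and Monte-Carlo testable.
- Literature.Barriers.CriticalPhenomena.RigorousRGSmallParameter: not engaged — nothing is expanded
and no fixed point is constructed; the Polchinski/SL flow enters only through an exact identity and
monotone envelopes (the bet: identities + inequalities along the flow are the RG's non-perturbative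
residue at λ = ∞).
- Literature.Barriers.CriticalPhenomena.PositionSpaceRGNonGibbsian: not engaged — μ_s is an honest
finite-volume Gibbs measure with a site-dependent field; no renormalised Hamiltonian is formed.
- Literature.Barriers.CriticalPhenomena.ScaleCovarianceNotMoebius: not engaged — clauses (i)–(ii)
are imported (MoebiusLimitExists), not upgraded.
- Literature.Barriers.CriticalPhenomena.BootstrapLatticeBlindness: evaded — every statement is about
the n.n. ℤ³ measure and its pl

History (route lifecycle, newest last):
- 2026-08-16T18:06:44Z · rev 6: restated Assembly (stmt-CriticalPhenomena-15887) — route-repair(cone) rev 6: re-run the NATIVE certification of closes through the statement type-check path — Assembly restated with the last arrow parenthesised (planner-rrepair-CriticalPhenomena-Localisation-b48c07b1-0)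
- 2026-09-01T18:02:53Z · DORMANT — reconciler: no traction for 5 d (last activity statement-checked at 2026-08-27T17:30:33Z); parked, not closed — `ledger route dormant route-CriticalPhenomena-Lo (operator:999:3018872)

sub-problem: Ising3DConformalLimit · status: dormant · opened planner-plan-novel-CriticalPhenomena-Ising3DCon-3ad144fc-v2-g3-0 2026-08-16T17:34:58Z · rev 6 · ledger route-CriticalPhenomena-LocalisationClock
GENERATED by the gate from the ledger (D-0016/17). Provers cite these decls: `theorem foo : Summit.CriticalPhenomena.Ising3DConformalLimit.Theses.LocalisationClock.<Decl> := …` in Summits/CriticalPhenomena/Ising3DConformalLimit/Theorems/<Name>.lean.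
-/

namespace Summit.CriticalPhenomena.Ising3DConformalLimit.Theses.LocalisationClock

open scoped BigOperators Topology Manifold Classical MeasureTheory ProbabilityTheory Matrix InnerProductSpace ComplexConjugate ContinuousMap
open Filter Set Function TopologicalSpace MeasureTheory

attribute [summit_statement] _root_.Ising3DConformalLimit

/-- item stmt-CriticalPhenomena-15881 · target · rank 0 · open · by planner
why it might fail: it IS non-triviality at block level: g_L → 0 iff the block spin is asymptotically Gaussian (Newman/Aizenman U₄ criterion); numerics give g_L → 3·0.47-type Binder values > 0 but no rigorous floor exists in d = 3.
sources: Aizenman1982, AizenmanDuminilCopinAnnals2021, Newman1975, DuminilCopinICM2022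
[target] block form of clause (iii): the dimensionless block coupling g_L = (3⟨M_L²⟩² −
⟨M_L⁴⟩)/⟨M_L²⟩² of the critical + state on ℤ³ (M_L = total spin of box 3 L) has a positive floor for
all large L (the expression is verbatim that of the shared support item 4950). -/
@[route_item "route-CriticalPhenomena-LocalisationClock"]
def Target : Prop :=
  ∃ c : ℝ, 0 < c ∧ ∃ L₀ : ℕ, ∀ L ≥ L₀, c ≤ (3 * (Literature.Probability.LatticeModels.plusExpect 3 (Literature.Probability.LatticeModels.criticalBeta 3) 0 (fun σ => (∑ x ∈ Literature.Probability.LatticeModels.box 3 L, Literature.Probability.LatticeModels.spinAt x σ) ^ 2)) ^ 2 - Literature.Probability.LatticeModels.plusExpect 3 (Literature.Probability.LatticeModels.criticalBeta 3) 0 (fun σ => (∑ x ∈ Literature.Probability.LatticeModels.box 3 L, Literature.Probability.LatticeModels.spinAt x σ) ^ 4)) / (Literature.Probability.LatticeModels.plusExpect 3 (Literature.Probability.LatticeModels.criticalBeta 3) 0 (fun σ => (∑ x ∈ Literature.Probability.LatticeModels.box 3 L, Literature.Probability.LatticeModels.spinAt x σ) ^ 2)) ^ 2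

/-- item stmt-CriticalPhenomena-15882 · crux · rank 2 · open · by planner
why it might fail: no pathwise monotonicity of truncated correlations along signed field rays (Ding–Song–Sun Rem. 1.4): the sign must come from the planted average (Nishimori) and could fail at intermediate s on frustrated-looking fields of non-negligible weight, or under partial observation (tested only to N ≤ 5).
sources: arXiv:2107.09243, arXiv:1806.09087, arXiv:2109.00709, doi:10.1103/physreve.60.132, Lebowitz1974
[crux] SL-GHS, block form with partial observation (card K1 in the weakest form the assembly needs):
for every finite set of sites with ferromagnetic pair couplings c ≥ 0 (zero field), every observed
block e ⊆ sites and every SNR s ≥ 0 — with σ* ~ Gibbs(c), Z standard Gaussian, fields y_a = sσ*_a +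
√s Z_a on the block and 0 off it, posterior = Gibbs(c) tilted by e^⟨y,σ⟩, block spin M_e = Σ_(a∈e)
σ_a, m(y) = E_y M_e, r(y) = Σ_(a∈e) Cov_y(σ_a, M_e)² (the clock rate) — E[r·m²] ≤ E[r]·E[m²] over
the planted law. The posterior block stiffness and the squared posterior block polarisation are
negatively correlated: an inequality interpolating Lebowitz (coefficient 2s²·U₄(G𝟙,𝟙,G𝟙,G𝟙) ≤ 0 at s
→ 0), GHS (coherent field) and Wick (≡ 0 for Gaussian laws); product measures satisfy it sitewise
(Chebyshev). The general-f ≥ 0 version of the card is the natural strengthening, not filed.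
[difficulty: L] -/
@[route_item "route-CriticalPhenomena-LocalisationClock", crux]
def LocalisationGHS : Prop :=
  ∀ (n : ℕ) (c : Fin n → Fin n → ℝ) (e : Fin n → Bool) (s : ℝ), (∀ a b, 0 ≤ c a b) → 0 ≤ s → let tilt : (Fin n → ℝ) → (Literature.Probability.LatticeModels.SpinConfig (Fin n) → ℝ) → ℝ := fun y g => Literature.Probability.LatticeModels.PairIsing.gibbsAvg c (fun σ => g σ * Real.exp (∑ a, y a * Literature.Probability.LatticeModels.spinAt a σ)) / Literature.Probability.LatticeModels.PairIsing.gibbsAvg c (fun σ => Real.exp (∑ a, y a * Literature.Probability.LatticeModels.spinAt a σ)); let blk : Literature.Probability.LatticeModels.SpinConfig (Fin n) → ℝ := fun σ => ∑ a, if e a then Literature.Probability.LatticeModels.spinAt a σ else 0; let m : (Fin n → ℝ) → ℝ := fun y => tilt y blk; let Af : (Fin n → ℝ) → Fin n → ℝ := fun y a => tilt y (fun σ => Literature.Probability.LatticeModels.spinAt a σ * blk σ) - tilt y (Literature.Probability.LatticeModels.spinAt a) * m y; let r : (Fin n → ℝ) → ℝ := fun y => ∑ a, if e a then Af y a ^ 2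 else 0; let P : ((Fin n → ℝ) → ℝ) → ℝ := fun Φ => Literature.Probability.LatticeModels.PairIsing.gibbsAvg c (fun σ => ∫ z, Φ (fun a => if e a then s * Literature.Probability.LatticeModels.spinAt a σ + Real.sqrt s * z a else 0) ∂(Measure.pi fun _ : Fin n => ProbabilityTheory.gaussianReal 0 1)); P (fun y => r y * m y ^ 2) ≤ P r * P (fun y => m y ^ 2)

/-- item stmt-CriticalPhenomena-15883 · crux · rank 3 · open · by planner
why it might fail: self-averaging returns if screening at the window is decided by many weakly dependent sub-block events (CLT ⇒ std r_s/E r_s → 0, as in d ≥ 4 where g_L → 0 forces it); the bet (Aharony–Harris, y_RF = 1 − η/2 > 0) is O(1) sub-blocks at ξ_RF(t*) = L; only toy evidence (ratio 0.3–0.7, N ≤ 5).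
sources: doi:10.1103/physrevlett.77.3700, arXiv:2107.09243, arXiv:2307.07619, AizenmanDuminilCopinAnnals2021
[crux] anti-concentration of the critical clock (card K2, sharpened to ONE inequality on a
parameter-free window): for the marginal w_L of the critical + state of ℤ³ on box 3 L, localised
through the Gaussian channel on the box with f = 𝟙 (block spin), there are 0 < a < b < 1 and c > 0
such that for all large L and every s ≥ 0 with a·σ_L² ≤ E M_s² ≤ b·σ_L² (the interquantile window of
the clock, which the DSS/FKG/Riccati envelopes place at the Imry–Ma time s ≍ |Λ_L|/σ_L² ≍ L^-(2−η)):
Cov(r_s, M_s²) ≤ −c·E r_s·E M_s². Order-one relative noise of the planted block susceptibility and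
its order-one anti-correlation with the squared polarisation at the crossover ξ_RF(s) ≍ L. [deps:
LocalisationGHS] [difficulty: open-problem] -/
@[route_item "route-CriticalPhenomena-LocalisationClock", crux]
def ImryMaWindowNoise : Prop :=
  let βc : ℝ := Literature.Probability.LatticeModels.criticalBeta 3; let w : (L : ℕ) → (↥(Literature.Probability.LatticeModels.box 3 L) → ℤˣ) → ℝ := fun L τ => Literature.Probability.LatticeModels.plusExpect 3 βc 0 (fun σ => if (∀ x : ↥(Literature.Probability.LatticeModels.box 3 L), σ x = τ x) then 1 else 0); let tilt : (L : ℕ) → (↥(Literature.Probability.LatticeModels.box 3 L) → ℝ) → ((↥(Literature.Probability.LatticeModels.box 3 L) → ℤˣ) → ℝ) → ℝ := fun L y g => (∑ τ, w L τ * g τ * Real.exp (∑ x, y x * ((τ x : ℤ) : ℝ))) / (∑ τ, w L τ * Real.exp (∑ x, y x * ((τ x : ℤ) : ℝ))); let m : (L : ℕ) → (↥(Literature.Probability.LatticeModels.box 3 L) → ℝ) → ℝ := fun L y => tilt L y (fun τ => ∑ x, ((τ x : ℤ) : ℝ)); let Af : (L : ℕ) → (↥(Literature.Probability.LatticeModels.box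 3 L) → ℝ) → ↥(Literature.Probability.LatticeModels.box 3 L) → ℝ := fun L y x => tilt L y (fun τ => ((τ x : ℤ) : ℝ) * ∑ x', ((τ x' : ℤ) : ℝ)) - tilt L y (fun τ => ((τ x : ℤ) : ℝ)) * m L y; let r : (L : ℕ) → (↥(Literature.Probability.LatticeModels.box 3 L) → ℝ) → ℝ := fun L y => ∑ x, Af L y x ^ 2; let P : (L : ℕ) → ℝ → ((↥(Literature.Probability.LatticeModels.box 3 L) → ℝ) → ℝ) → ℝ := fun L s Φ => ∑ τ, w L τ * ∫ z, Φ (fun x => s * ((τ x : ℤ) : ℝ) + Real.sqrt s * z x) ∂(Measure.pi fun _ : ↥(Literature.Probability.LatticeModels.box 3 L) => ProbabilityTheory.gaussianReal 0 1); let σ2 : ℕ → ℝ := fun L => Literature.Probability.LatticeModels.plusExpect 3 βc 0 (fun σ => (∑ x ∈ Literature.Probability.LatticeModels.box 3 L, Literature.Probability.LatticeModels.spinAt x σ) ^ 2); ∃ a b c : ℝ, 0 < a ∧ a < b ∧ b < 1 ∧ 0 < c ∧ ∃ L₀ : ℕ, ∀ L ≥ L₀, ∀ s : ℝ, 0 ≤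 s → a * σ2 L ≤ P L s (fun y => m L y ^ 2) → P L s (fun y => m L y ^ 2) ≤ b * σ2 L → P L s (fun y => r L y * m L y ^ 2) - P L s (r L) * P L s (fun y => m L y ^ 2) ≤ -(c * (P L s (r L) * P L s (fun y => m L y ^ 2)))

/-- item stmt-CriticalPhenomena-1344 · crux · rank 4 · open · by planner
why it might fail: existence of the full δ→0⁺ limit, O(3) invariance and inversion covariance are each open on ℤ³ (ICM 2022 §8.4 p.29); Euclidean + scale data never force inversion (ScaleCovarianceNotMoebius); imported, not attacked.
sources: DuminilCopinICM2022, PolandRychkovVichi2019, Literature.Barriers.CriticalPhenomena.ScaleCovarianceNotMoebius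
[crux] r5 = MoebLim (IMPORTED COMPLEMENT, lowest rank): the critical Ising correlators on ℤ³ have a
non-degenerate pointwise scaling limit (ρ > 0 on (0,1], Δ > 0, S) that is Möbius covariant with
dimension Δ — the conjunct Ising3DConformalLimit minus clause (iii). Written verbatim as the
conjunct's definiens without '∧ HasNontrivialU4 S' so that other routes filing the same complement
attach here. This route does not attack existence, rotation or inversion covariance; it bets on the
covariance lines (IsingEuclidUpgrade r5/r6 = items 0637/0638, IsingCFTData r2 = 0665, cards
hyperoctahedral-rp-rigidity / inversion-first-moebius-from-translations). S may be taken 0 off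
NonCoincident, so no coincident-configuration junk obstructs the existential. -/
@[route_item "route-CriticalPhenomena-LocalisationClock", crux]
def MoebiusLimitExists : Prop :=
  ∃ (ρ : ℝ → ℝ) (Δ : ℝ) (S : Literature.Probability.LatticeModels.CorrFamily 3), (∀ δ ∈ Set.Ioc (0:ℝ) 1, 0 < ρ δ) ∧ 0 < Δ ∧ Literature.Probability.LatticeModels.HasPointwiseScalingLimit (Literature.Probability.LatticeModels.criticalCorr 3) ρ S ∧ Literature.Probability.LatticeModels.IsNondegenerateTwoPoint S ∧ Literature.Probability.LatticeModels.IsMoebiusCovariant Δ S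

/-- item stmt-CriticalPhenomena-15884 · crux · rank 9 · open · by planner
why it might fail: needs ClockIdentity in Lean (Itô/Gaussian calculus absent from Mathlib) and the passage free boxes → + state via uniqueness at β_c (ADS named fact); any normalisation slip between the plusExpect marginal and the PairIsing tilt functional breaks the exact match the sign transfer needs.
sources: arXiv:1806.09087, FriedliVelenik2017, AizenmanDuminilCopinSidoravicius2015, arXiv:2107.09243
[support] the clock reading: LocalisationGHS → ImryMaWindowNoise → Target. Proof (planner NOTES
§Route design): (1) ClockIdentity for the symmetric finite law w_L (the + state at β_c(3) is
flip-symmetric: m*(β_c) = 0, ADS 2015, in-tree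
MagnetizationContinuity/LebowitzMagnetizationCriterion) with f = 𝟙 gives 6∫₀^∞ Cov = ⟨M⁴⟩ − 3⟨M²⟩²
and ∫_(s₁)^(s₂) E r = E M_(s₂)² − E M_(s₁)²; (2) LocalisationGHS applied to the free-b.c. zero-field
boxes Λ' ⊇ Λ_L (PairIsing.gibbsAvg with c = β_c·adjacency, mask e = 𝟙_Λ, f = 𝟙_Λ) is EXACTLY the
clock functional of the Λ-marginal of μ^free_(Λ'); it is continuous in that finite law, and
μ^free_(Λ') → + state at β_c (uniqueness), so Cov_L(s) ≤ 0 for all s; (3) s ↦ E M_s² is continuous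
nondecreasing from 0 to σ_L², so the window [s₁,s₂] with E M² = aσ², bσ² exists and carries ∫E r =
(b−a)σ_L²; on it −Cov ≥ c·aσ_L²·E r_s, hence 3⟨M²⟩² − ⟨M⁴⟩ = −κ₄ ≥ 6ca(b−a)σ_L⁴. [difficulty: M] -/
@[route_item "route-CriticalPhenomena-LocalisationClock", crux]
def TargetOfClock : Prop :=
  LocalisationGHS → ImryMaWindowNoise → Target

/-- item stmt-CriticalPhenomena-15886 · crux · rank 9 · closed · proved by Summit.CriticalPhenomena.Ising3DConformalLimit.LocalisationClockGaussianLimitKillsBlockCoupling.gaussianLimitKillsBlockCoupling_proof @ 9aadc35bbc92 (prover) · by planner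
why it might fail: near-diagonal control needs regular variation of ρ along the full filter plus Potter bounds and MMS doubling uniformly in L; Mathlib has no Karamata theory (in-tree IsSlowlyVarying files are partial); a non-regularly-varying admissible ρ would void the ε^(3−2Δ) estimate.
sources: AizenmanDuminilCopinAnnals2021, Lebowitz1974, Literature.Probability.LatticeModels.messager_miracleSole_holds, Literature.Analysis.Asymptotics.IsSlowlyVarying
[support] SHARED transfer glue (item stmt-CriticalPhenomena-4950 of route LeeYangGap, verbatim): if
(ρ, Δ, S) is a pointwise scaling limit of criticalCorr 3 with non-degenerate two-point function,
scale covariant with dimension Δ, and U₄^S ≡ 0 on non-coincident configurations, then g_L → 0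
(Lebowitz + Griffiths pairing bound near the diagonal, locally uniform convergence off it, MMS
doubling and Potter bounds for the regularly varying normalisation). [difficulty: L] -/
@[route_item "route-CriticalPhenomena-LocalisationClock", crux]
def GaussianLimitKillsBlockCoupling : Prop :=
  ∀ (ρ : ℝ → ℝ) (Δ : ℝ) (S : Literature.Probability.LatticeModels.CorrFamily 3), (∀ δ ∈ Set.Ioc (0:ℝ) 1, 0 < ρ δ) → Literature.Probability.LatticeModels.HasPointwiseScalingLimit (Literature.Probability.LatticeModels.criticalCorr 3) ρ S → Literature.Probability.LatticeModels.IsNondegenerateTwoPoint S → Literature.Probability.LatticeModels.IsScaleCovariant Δ S → ¬ Literature.Probability.LatticeModels.HasNontrivialU4 S → Filter.Tendsto (fun L : ℕ => (3 * (Literature.Probability.LatticeModels.plusExpect 3 (Literature.Probability.LatticeModels.criticalBeta 3) 0 (fun σ => (∑ x ∈ Literature.Probability.LatticeModels.box 3 L, Literature.Probability.LatticeModels.spinAt x σ) ^ 2)) ^ 2 - Literature.Probability.LatticeModels.plusExpect 3 (Literature.Probability.LatticeModels.criticalBeta 3) 0 (fun σ => (∑ x ∈ Literature.Probability.LatticeModels.box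 3 L, Literature.Probability.LatticeModels.spinAt x σ) ^ 4)) / (Literature.Probability.LatticeModels.plusExpect 3 (Literature.Probability.LatticeModels.criticalBeta 3) 0 (fun σ => (∑ x ∈ Literature.Probability.LatticeModels.box 3 L, Literature.Probability.LatticeModels.spinAt x σ) ^ 2)) ^ 2) Filter.atTop (nhds 0)

-- `GaussianLimitKillsBlockCoupling` holds: proved by `Summit.CriticalPhenomena.Ising3DConformalLimit.LocalisationClockGaussianLimitKillsBlockCoupling.gaussianLimitKillsBlockCoupling_proof` @ 9aadc35bbc92 (its module imports this route file, so no `_holds` link can be stated here).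

/-- item stmt-CriticalPhenomena-15885 · support · rank 9 · open · by planner
sources: arXiv:1806.09087, doi:10.1214/15-aihp682, arXiv:2109.00709
[support] THE DICTIONARY (card P1, provable now by Gaussian calculus): for every finite
flip-symmetric probability weight w on (Fin n → ℤˣ) and every f, with the clock functionals of the
Gaussian channel (tilt by e^⟨y,τ⟩, m, Af, r as in LocalisationGHS with full observation, P_s =
planted expectation at SNR s, cov(s) = P_s[r m²] − P_s[r]P_s[m²]): (i) ∫_(s₁)^(s₂) P_s[r] ds =
P_(s₂)[m²] − P_(s₁)[m²] (the clock: d E M_s² = E r_s ds); (ii) cov is integrable on (0,∞); (iii)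
6∫₀^∞ cov = Σ w⟨f,τ⟩⁴ − 3(Σ w⟨f,τ⟩²)² = κ₄. Two lines of Itô for the continuous martingale M_s (or
de Bruijn/heat-equation differentiation under the Gaussian integral, which avoids stochastic
calculus in Lean). [difficulty: L] -/
@[route_item "route-CriticalPhenomena-LocalisationClock"]
def ClockIdentity : Prop :=
  ∀ (n : ℕ) (w : (Fin n → ℤˣ) → ℝ) (f : Fin n → ℝ), (∀ τ, 0 ≤ w τ) → ∑ τ, w τ = 1 → (∀ τ, w (-τ) = w τ) → let tilt : (Fin n → ℝ) → ((Fin n → ℤˣ) → ℝ) → ℝ := fun y g => (∑ τ, w τ * g τ * Real.exp (∑ a, y a * ((τ a : ℤ) : ℝ))) / (∑ τ, w τ * Real.exp (∑ a, y a * ((τ a : ℤ) : ℝ))); let m : (Fin n → ℝ) → ℝ := fun y => tilt y (fun τ => ∑ a, f a * ((τ a : ℤ) : ℝ)); let Af : (Fin n → ℝ) → Fin n → ℝ := fun y a => tilt y (fun τ => ((τ a : ℤ) : ℝ) * ∑ b, f b * ((τ b : ℤ) : ℝ)) - tilt y (fun τ => ((τ a : ℤ) : ℝ)) * m y; let r :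 (Fin n → ℝ) → ℝ := fun y => ∑ a, Af y a ^ 2; let P : ℝ → ((Fin n → ℝ) → ℝ) → ℝ := fun s Φ => ∑ τ, w τ * ∫ z, Φ (fun a => s * ((τ a : ℤ) : ℝ) + Real.sqrt s * z a) ∂(Measure.pi fun _ : Fin n => ProbabilityTheory.gaussianReal 0 1); let cov : ℝ → ℝ := fun s => P s (fun y => r y * m y ^ 2) - P s r * P s (fun y => m y ^ 2); (∀ s₁ s₂ : ℝ, 0 ≤ s₁ → s₁ ≤ s₂ → ∫ s in s₁..s₂, P s r = P s₂ (fun y => m y ^ 2) - P s₁ (fun y => m y ^ 2)) ∧ MeasureTheory.IntegrableOn cov (Set.Ioi 0) ∧ 6 * ∫ s in Set.Ioi 0, cov s = (∑ τ, w τ * (∑ a, f a * ((τ a : ℤ) : ℝ)) ^ 4) - 3 * (∑ τ, w τ * (∑ a, f a * ((τ a : ℤ) : ℝ)) ^ 2) ^ 2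

-- earlier Assembly (stmt-CriticalPhenomena-15887, replaced 2026-08-16T18:06:44Z -> stmt-CriticalPhenomena-16202): retired by None — LocalisationGHS → ImryMaWindowNoise → TargetOfClock → GaussianLimitKillsBlockCoupling → MoebiusLimitExists → _root_.Ising3DConformalLimit
/-- item stmt-CriticalPhenomena-16202 · assembly · rank 1 · open · by planner
sources: DuminilCopinICM2022, arXiv:1806.09087
[assembly] LocalisationGHS → ImryMaWindowNoise → TargetOfClock → GaussianLimitKillsBlockCoupling →
MoebiusLimitExists → Ising3DConformalLimit (same proof as `closes`). -/
@[route_item "route-CriticalPhenomena-LocalisationClock"]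
def Assembly : Prop :=
  LocalisationGHS → ImryMaWindowNoise → TargetOfClock → GaussianLimitKillsBlockCoupling → (MoebiusLimitExists → _root_.Ising3DConformalLimit)

/-! D-0027 §2.1 — DECIDING THEOREM (planner-authored via `route open/edit --closes-file`; by planner-rrepair-CriticalPhenomena-Localisation-b48c07b1-0 2026-08-16T18:06:44Z):
its hypotheses are this route's items and its conclusion the sub-problem Statement (glue_lint), and it elaborates with this file. -/

@[closes "route-CriticalPhenomena-LocalisationClock"] theorem closes (hGHS : LocalisationGHS) (hAH : ImryMaWindowNoise) (hT : TargetOfClock)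
    (hKill : GaussianLimitKillsBlockCoupling) (hM : MoebiusLimitExists) : _root_.Ising3DConformalLimit := by
  obtain ⟨ρ, Δ, S, hρ, hΔ, hlim, hnd, hmob⟩ := hM
  refine ⟨ρ, Δ, S, hρ, hΔ, hlim, hnd, hmob, ?_⟩
  by_contra hU4
  obtain ⟨c, hc, L₀, hL₀⟩ := hT hGHS hAH
  have htend := hKill ρ Δ S hρ hlim hnd hmob.isScaleCovariant hU4
  obtain ⟨L₁, hL₁⟩ := Filter.eventually_atTop.1 (htend.eventually (gt_mem_nhds hc))
  have h₀ := hL₀ (max L₀ L₁) (le_max_left L₀ L₁)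
  have h₁ : _ < c := hL₁ (max L₀ L₁) (le_max_right L₀ L₁)
  linarith

end Summit.CriticalPhenomena.Ising3DConformalLimit.Theses.LocalisationClock
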